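import Mathlib
import HarnessLib

/-!
# The monotone rational-quadratic spline segment: closed-form derivative, positivity, bijectivity of the bin, and the closed-form inverse the engine uses

HONEST FRAMING: exact (Metropolis-corrected) sampling algorithms for lattice gauge theory;
figures of merit are autocorrelation/cost numbers at stated couplings and volumes; no
continuum-physics claim.

Venture `LatticeQCDFlow` (cell pub-lqcd), topic `Exactness`; FANOUT row 10 (`eng-equiv`, the
gauge-equivariant layer library `latflow.equiv`; module `equiv/splines.py`, functions
`rqs_forward` / `rqs_inverse`, release `equiv-0.4.1`; the same formulas drive the spline couplings
of `latflow.flows_jax`).  NEW WORK of the cell over Mathlib (one-variable calculus); nothing is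
cited as a fact; no number.  Printed counterparts, NAMED ONLY: Gregory–Delbourgo 1982 (the
monotone rational-quadratic interpolant), Durkan–Bekasov–Murray–Papamakarios 2019 "Neural spline
flows" eqs. (4)–(8) (the segment, its derivative, the inverse by the stable quadratic root),
Rezende et al. 2020 (circular splines on tori), Kanwar et al. 2020 / Boyda et al. 2021 (spline and
NCP couplings in gauge-equivariant flows).

## The object

One bin of a rational-quadratic spline has width `w > 0`, height `h > 0`, slope `s = h / w`, and
prescribed POSITIVE derivatives `d₀`, `d₁` at its two knots.  In the normalised abscissa
`ξ = (x − x₀)/w ∈ [0, 1]` the segment is `y = y₀ + h · R(ξ)` with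

  `R(ξ)  = (s ξ² + d₀ ξ(1−ξ)) / (s + (d₁ + d₀ − 2s) ξ(1−ξ))`,
  `R'(ξ) = s (d₁ ξ² + 2s ξ(1−ξ) + d₀ (1−ξ)²) / (s + (d₁ + d₀ − 2s) ξ(1−ξ))²`,

so that `dy/dx = s · R'(ξ) = s² (d₁ ξ² + 2s ξ(1−ξ) + d₀(1−ξ)²) / den²` — literally the engine's
`dydx` (`rqs_forward` / `rqs_inverse`).  The inverse solves `A ξ² + B ξ + C = 0` with
`A = (s − d₀) + (d₁ + d₀ − 2s) η`, `B = d₀ − (d₁ + d₀ − 2s) η`, `C = −s η` (`η = (y − y₀)/h`; the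
engine's `a, b, c` are these times `h`) by the root `ξ = 2C / (−B − √(B² − 4AC))
= 2sη / (B + √(B² + 4Asη))`, which is invariant under that scaling.  All statements are about
these explicit expressions (no definition is introduced).

## Content (hypotheses `0 < s`, `0 < d₀`, `0 < d₁` throughout)

* `rqs_den_pos` — the denominator is positive on the bin
  (`den = s(ξ² + (1−ξ)²) + (d₀ + d₁) ξ(1−ξ)`); `rqs_derivNum_pos` — so is the derivative's numerator;
* `rqs_apply_zero/one`, `rqsDeriv_apply_zero/one` — `R(0) = 0`, `R(1) = 1`, `R'(0) = d₀/s`,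
  `R'(1) = d₁/s` (so `dy/dx` is `d₀`, `d₁` at the knots: consecutive bins glue `C¹`);
* **`hasDerivAt_rqs`** — the closed-form derivative, at every point of the CLOSED bin;
  `rqsDeriv_pos`; `continuousOn_rqs`; **`strictMonoOn_rqs`**; **`rqs_bijOn`** — `R` is a strictly
  increasing bijection of `[0, 1]` onto itself;
* the inverse: `rqs_discr_eq_sq` / `rqs_discr_nonneg` (the discriminant is a square at any
  preimage, hence `≥ 0` on `η ∈ [0,1]`), `rqs_invDen_pos` (`B + √Δ > 0`: the stable root never
  divides by zero), **`rqs_inv_mem_Icc`**, **`rqs_apply_inv`** (`R(ξ*(η)) = η`) and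
  **`rqs_inv_apply`** (`ξ*(R ξ) = ξ`) — the engine's `rqs_inverse` is the exact two-sided inverse of
  `rqs_forward` on every bin, not a Newton/bisection approximation;
* the physical bin: **`hasDerivAt_rqsBin`** (`d/dx [y₀ + h R((x−x₀)/w)] = s R'((x−x₀)/w)`),
  `rqsBin_dydx_eq` (that value is the engine's `s²(…)/den²`), `rqsBin_apply_left/right`,
  `rqsBin_deriv_left/right` (values `y₀`, `y₀ + h` and slopes `d₀`, `d₁` at the knots).

NOT here: the gluing of `K` bins into one `C¹` map of `[0,1]` / a degree-one lift of the circle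
(then `CircleDegreeOneJacobian.hasJacobian_circle_of_degreeOne` certifies the circular spline
coupling as `NCPCircleJacobian` does for NCP) — the sequel; the parameter maps (`softmax` /
`softplus`, minimum bin sizes) — only positivity is used; any network.
-/

noncomputable section

namespace Summit.Ventures.LatticeQCDFlow.Exactness

open Real Set

/-! ## The normalised segment `R : [0,1] → [0,1]` -/

section Segment

variable {s d₀ d₁ : ℝ}

/-- The denominator rearranged: `s + (d₁ + d₀ − 2s) ξ(1−ξ) = s (ξ² + (1−ξ)²) + (d₀ + d₁) ξ(1−ξ)`. -/
theorem rqs_den_eq (s d₀ d₁ ξ : ℝ) :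
    s + (d₁ + d₀ - 2 * s) * (ξ * (1 - ξ)) =
      s * (ξ ^ 2 + (1 - ξ) ^ 2) + (d₀ + d₁) * (ξ * (1 - ξ)) := by
  ring

/-- **The denominator is positive on the bin**: for `0 < s, d₀, d₁` and `ξ ∈ [0,1]`,
`0 < s + (d₁ + d₀ − 2s) ξ(1−ξ)`. -/
theorem rqs_den_pos (hs : 0 < s) (hd₀ : 0 < d₀) (hd₁ : 0 < d₁) {ξ : ℝ} (h0 : 0 ≤ ξ)
    (h1 : ξ ≤ 1) : 0 < s + (d₁ + d₀ - 2 * s) * (ξ * (1 - ξ)) := by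
  rw [rqs_den_eq]
  have hξ : 0 ≤ ξ * (1 - ξ) := mul_nonneg h0 (by linarith)
  have hsq : 0 < ξ ^ 2 + (1 - ξ) ^ 2 := by nlinarith [sq_nonneg (ξ - 1 / 2)]
  have h2 : 0 ≤ (d₀ + d₁) * (ξ * (1 - ξ)) := mul_nonneg (by linarith) hξ
  nlinarith [mul_pos hs hsq]

/-- **The derivative's numerator is positive on the bin**: for `0 < s, d₀, d₁` and `ξ ∈ [0,1]`,
`0 < d₁ ξ² + 2s ξ(1−ξ) + d₀ (1−ξ)²`. -/
theorem rqs_derivNum_pos (hs : 0 < s) (hd₀ : 0 < d₀) (hd₁ : 0 < d₁) {ξ : ℝ} (h0 : 0 ≤ ξ)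
    (h1 : ξ ≤ 1) : 0 < d₁ * ξ ^ 2 + 2 * s * (ξ * (1 - ξ)) + d₀ * (1 - ξ) ^ 2 := by
  have hξ : 0 ≤ ξ * (1 - ξ) := mul_nonneg h0 (by linarith)
  have hA : 0 ≤ d₁ * ξ ^ 2 := mul_nonneg hd₁.le (sq_nonneg ξ)
  have hB : 0 ≤ d₀ * (1 - ξ) ^ 2 := mul_nonneg hd₀.le (sq_nonneg (1 - ξ))
  have hC : 0 ≤ 2 * s * (ξ * (1 - ξ)) := mul_nonneg (by linarith) hξ
  by_cases hle : ξ ≤ 1 / 2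
  · have h4 : 1 / 4 ≤ (1 - ξ) ^ 2 := by nlinarith
    nlinarith [mul_le_mul_of_nonneg_left h4 hd₀.le]
  · have h4 : 1 / 4 ≤ ξ ^ 2 := by nlinarith
    nlinarith [mul_le_mul_of_nonneg_left h4 hd₁.le]

/-- `R(0) = 0`. -/
theorem rqs_apply_zero (s d₀ d₁ : ℝ) :
    (s * (0 : ℝ) ^ 2 + d₀ * (0 * (1 - 0))) / (s + (d₁ + d₀ - 2 * s) * (0 * (1 - 0))) = 0 := by
  simp

/-- `R(1) = 1` (for `s ≠ 0`). -/
theorem rqs_apply_one (hs : s ≠ 0) (d₀ d₁ : ℝ) :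
    (s * (1 : ℝ) ^ 2 + d₀ * (1 * (1 - 1))) / (s + (d₁ + d₀ - 2 * s) * (1 * (1 - 1))) = 1 := by
  simp [hs]

/-- `R'(0) = d₀ / s` (for `s ≠ 0`). -/
theorem rqsDeriv_apply_zero (hs : s ≠ 0) (d₀ d₁ : ℝ) :
    s * (d₁ * (0 : ℝ) ^ 2 + 2 * s * (0 * (1 - 0)) + d₀ * (1 - 0) ^ 2) /
        (s + (d₁ + d₀ - 2 * s) * (0 * (1 - 0))) ^ 2 = d₀ / s := by
  have h1 : s * (d₁ * (0 : ℝ) ^ 2 + 2 * s * (0 * (1 - 0)) + d₀ * (1 - 0) ^ 2) = s * d₀ := by ring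
  have h2 : (s + (d₁ + d₀ - 2 * s) * ((0 : ℝ) * (1 - 0))) ^ 2 = s * s := by ring
  rw [h1, h2, mul_div_mul_left _ _ hs]

/-- `R'(1) = d₁ / s` (for `s ≠ 0`). -/
theorem rqsDeriv_apply_one (hs : s ≠ 0) (d₀ d₁ : ℝ) :
    s * (d₁ * (1 : ℝ) ^ 2 + 2 * s * (1 * (1 - 1)) + d₀ * (1 - 1) ^ 2) /
        (s + (d₁ + d₀ - 2 * s) * (1 * (1 - 1))) ^ 2 = d₁ / s := by
  have h1 : s * (d₁ * (1 : ℝ) ^ 2 + 2 * s * (1 * (1 - 1)) + d₀ * (1 - 1) ^ 2) = s * d₁ := by ring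
  have h2 : (s + (d₁ + d₀ - 2 * s) * ((1 : ℝ) * (1 - 1))) ^ 2 = s * s := by ring
  rw [h1, h2, mul_div_mul_left _ _ hs]

/-- The numerator `s ξ² + d₀ ξ(1−ξ)` has derivative `2s ξ + d₀ (1 − 2ξ)`. -/
theorem hasDerivAt_rqs_num (s d₀ ξ : ℝ) :
    HasDerivAt (fun x : ℝ => s * x ^ 2 + d₀ * (x * (1 - x))) (2 * s * ξ + d₀ * (1 - 2 * ξ)) ξ := by
  have h1 : HasDerivAt (fun x : ℝ => x ^ 2) (2 * ξ) ξ := by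
    simpa using hasDerivAt_pow 2 ξ
  have h2 : HasDerivAt (fun x : ℝ => x * (1 - x)) (1 * (1 - ξ) + ξ * (0 - 1)) ξ :=
    (hasDerivAt_id' ξ).fun_mul ((hasDerivAt_const ξ (1 : ℝ)).fun_sub (hasDerivAt_id' ξ))
  exact ((h1.const_mul s).fun_add (h2.const_mul d₀)).congr_deriv (by ring)

/-- The denominator `s + (d₁ + d₀ − 2s) ξ(1−ξ)` has derivative `(d₁ + d₀ − 2s)(1 − 2ξ)`. -/
theorem hasDerivAt_rqs_den (s d₀ d₁ ξ : ℝ) :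
    HasDerivAt (fun x : ℝ => s + (d₁ + d₀ - 2 * s) * (x * (1 - x)))
      ((d₁ + d₀ - 2 * s) * (1 - 2 * ξ)) ξ := by
  have h2 : HasDerivAt (fun x : ℝ => x * (1 - x)) (1 * (1 - ξ) + ξ * (0 - 1)) ξ :=
    (hasDerivAt_id' ξ).fun_mul ((hasDerivAt_const ξ (1 : ℝ)).fun_sub (hasDerivAt_id' ξ))
  exact ((h2.const_mul (d₁ + d₀ - 2 * s)).const_add s).congr_deriv (by ring)

/-- **The closed-form derivative of the segment** (Durkan et al. eq. (5), the engine's `dydx / s`):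
wherever the denominator does not vanish — in particular at every point of the closed bin —
`d/dξ R(ξ) = s (d₁ ξ² + 2s ξ(1−ξ) + d₀(1−ξ)²) / den(ξ)²`. -/
theorem hasDerivAt_rqs {ξ : ℝ} (hden : s + (d₁ + d₀ - 2 * s) * (ξ * (1 - ξ)) ≠ 0) :
    HasDerivAt (fun x : ℝ => (s * x ^ 2 + d₀ * (x * (1 - x))) / (s + (d₁ + d₀ - 2 * s) * (x * (1 - x))))
      (s * (d₁ * ξ ^ 2 + 2 * s * (ξ * (1 - ξ)) + d₀ * (1 - ξ) ^ 2) /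
        (s + (d₁ + d₀ - 2 * s) * (ξ * (1 - ξ))) ^ 2) ξ := by
  have h := (hasDerivAt_rqs_num s d₀ ξ).div (hasDerivAt_rqs_den s d₀ d₁ ξ) hden
  refine h.congr_deriv ?_
  congr 1
  ring

/-- **The derivative is positive on the bin.** -/
theorem rqsDeriv_pos (hs : 0 < s) (hd₀ : 0 < d₀) (hd₁ : 0 < d₁) {ξ : ℝ} (h0 : 0 ≤ ξ) (h1 : ξ ≤ 1) :
    0 < s * (d₁ * ξ ^ 2 + 2 * s * (ξ * (1 - ξ)) + d₀ * (1 - ξ) ^ 2) /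
        (s + (d₁ + d₀ - 2 * s) * (ξ * (1 - ξ))) ^ 2 :=
  div_pos (mul_pos hs (rqs_derivNum_pos hs hd₀ hd₁ h0 h1)) (pow_pos (rqs_den_pos hs hd₀ hd₁ h0 h1) 2)

/-- The segment is continuous on the closed bin. -/
theorem continuousOn_rqs (hs : 0 < s) (hd₀ : 0 < d₀) (hd₁ : 0 < d₁) :
    ContinuousOn (fun x : ℝ => (s * x ^ 2 + d₀ * (x * (1 - x))) /
      (s + (d₁ + d₀ - 2 * s) * (x * (1 - x)))) (Icc 0 1) := fun _ hξ =>
  (hasDerivAt_rqs (rqs_den_pos hs hd₀ hd₁ hξ.1 hξ.2).ne').continuousAt.continuousWithinAt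

/-- **The segment is strictly increasing on the bin.** -/
theorem strictMonoOn_rqs (hs : 0 < s) (hd₀ : 0 < d₀) (hd₁ : 0 < d₁) :
    StrictMonoOn (fun x : ℝ => (s * x ^ 2 + d₀ * (x * (1 - x))) /
      (s + (d₁ + d₀ - 2 * s) * (x * (1 - x)))) (Icc 0 1) := by
  refine strictMonoOn_of_deriv_pos (convex_Icc 0 1) (continuousOn_rqs hs hd₀ hd₁) fun ξ hξ => ?_
  rw [interior_Icc] at hξ
  rw [(hasDerivAt_rqs (rqs_den_pos hs hd₀ hd₁ hξ.1.le hξ.2.le).ne').deriv]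
  exact rqsDeriv_pos hs hd₀ hd₁ hξ.1.le hξ.2.le

/-- The segment maps the bin into `[0, 1]`. -/
theorem rqs_mapsTo (hs : 0 < s) (hd₀ : 0 < d₀) (hd₁ : 0 < d₁) :
    MapsTo (fun x : ℝ => (s * x ^ 2 + d₀ * (x * (1 - x))) /
      (s + (d₁ + d₀ - 2 * s) * (x * (1 - x)))) (Icc 0 1) (Icc 0 1) := by
  intro ξ hξ
  have hmono := (strictMonoOn_rqs hs hd₀ hd₁).monotoneOn
  have h0 : (0 : ℝ) ∈ Icc (0 : ℝ) 1 := ⟨le_rfl, zero_le_one⟩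
  have h1 : (1 : ℝ) ∈ Icc (0 : ℝ) 1 := ⟨zero_le_one, le_rfl⟩
  have hl := hmono h0 hξ hξ.1
  have hr := hmono hξ h1 hξ.2
  simp only [rqs_apply_zero] at hl
  simp only [rqs_apply_one hs.ne'] at hr
  exact ⟨hl, hr⟩

/-- **The segment is a bijection of the bin onto `[0, 1]`** (strictly increasing, continuous,
`R(0) = 0`, `R(1) = 1`). -/
theorem rqs_bijOn (hs : 0 < s) (hd₀ : 0 < d₀) (hd₁ : 0 < d₁) :
    BijOn (fun x : ℝ => (s * x ^ 2 + d₀ * (x * (1 - x))) /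
      (s + (d₁ + d₀ - 2 * s) * (x * (1 - x)))) (Icc 0 1) (Icc 0 1) := by
  refine ⟨rqs_mapsTo hs hd₀ hd₁, (strictMonoOn_rqs hs hd₀ hd₁).injOn, ?_⟩
  have h := intermediate_value_Icc zero_le_one (continuousOn_rqs hs hd₀ hd₁)
  simp only [rqs_apply_zero, rqs_apply_one hs.ne'] at h
  exact h

/-! ## The closed-form inverse (the stable quadratic root of `rqs_inverse`) -/

/-- The quadratic solved by the inverse: `R(ξ) = η` with non-vanishing denominator is
`A ξ² + B ξ + C = 0`, `A = (s − d₀) + (d₁ + d₀ − 2s) η`, `B = d₀ − (d₁ + d₀ − 2s) η`, `C = −s η`. -/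
theorem rqs_quadratic_eq_zero {ξ η : ℝ} (hden : s + (d₁ + d₀ - 2 * s) * (ξ * (1 - ξ)) ≠ 0)
    (h : (s * ξ ^ 2 + d₀ * (ξ * (1 - ξ))) / (s + (d₁ + d₀ - 2 * s) * (ξ * (1 - ξ))) = η) :
    ((s - d₀) + (d₁ + d₀ - 2 * s) * η) * ξ ^ 2 + (d₀ - (d₁ + d₀ - 2 * s) * η) * ξ + -(s * η) = 0 := by
  rw [div_eq_iff hden] at h
  linear_combination h

/-- **The discriminant is a square at any root**: if `A ξ² + B ξ + C = 0` then
`B² − 4AC = (2Aξ + B)²` (also when `A = 0`). -/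
theorem rqs_discr_eq_sq {ξ η : ℝ}
    (h : ((s - d₀) + (d₁ + d₀ - 2 * s) * η) * ξ ^ 2 + (d₀ - (d₁ + d₀ - 2 * s) * η) * ξ + -(s * η) = 0) :
    (d₀ - (d₁ + d₀ - 2 * s) * η) ^ 2 + 4 * ((s - d₀) + (d₁ + d₀ - 2 * s) * η) * (s * η) =
      (2 * ((s - d₀) + (d₁ + d₀ - 2 * s) * η) * ξ + (d₀ - (d₁ + d₀ - 2 * s) * η)) ^ 2 := by
  linear_combination (-4 * ((s - d₀) + (d₁ + d₀ - 2 * s) * η)) * h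

/-- **The discriminant is non-negative on the image**: for `η ∈ [0, 1]` (so that `η = R(ξ)` for
some `ξ` in the bin), `0 ≤ B² + 4Asη` (`= B² − 4AC`). -/
theorem rqs_discr_nonneg (hs : 0 < s) (hd₀ : 0 < d₀) (hd₁ : 0 < d₁) {η : ℝ} (h0 : 0 ≤ η)
    (h1 : η ≤ 1) :
    0 ≤ (d₀ - (d₁ + d₀ - 2 * s) * η) ^ 2 + 4 * ((s - d₀) + (d₁ + d₀ - 2 * s) * η) * (s * η) := by
  obtain ⟨ξ, hξ, hξη⟩ := (rqs_bijOn hs hd₀ hd₁).surjOn ⟨h0, h1⟩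
  rw [rqs_discr_eq_sq (rqs_quadratic_eq_zero (rqs_den_pos hs hd₀ hd₁ hξ.1 hξ.2).ne' hξη)]
  exact sq_nonneg _

/-- **The stable root never divides by zero**: for `η ≥ 0` (and any `d₁`), `0 < B + √(B² + 4Asη)`. -/
theorem rqs_invDen_pos (hs : 0 < s) (hd₀ : 0 < d₀) (d₁ : ℝ) {η : ℝ} (h0 : 0 ≤ η) :
    0 < (d₀ - (d₁ + d₀ - 2 * s) * η) +
      √((d₀ - (d₁ + d₀ - 2 * s) * η) ^ 2 + 4 * ((s - d₀) + (d₁ + d₀ - 2 * s) * η) * (s * η)) := by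
  set B := d₀ - (d₁ + d₀ - 2 * s) * η with hB
  set A := (s - d₀) + (d₁ + d₀ - 2 * s) * η with hA
  have hsq := Real.sqrt_nonneg (B ^ 2 + 4 * A * (s * η))
  by_cases hBpos : 0 < B
  · linarith
  · have hBle : B ≤ 0 := not_lt.1 hBpos
    -- `B ≤ 0` forces `η > 0` and `A ≥ s > 0`, so `√Δ > |B|`.
    have hη : 0 < η := by
      rcases h0.lt_or_eq with h | h
      · exact h
      · exfalso; rw [← h] at hB; simp only [mul_zero, sub_zero] at hB; linarith
    have hAs : s ≤ A := by rw [hA]; linarith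
    have hΔ : B ^ 2 < B ^ 2 + 4 * A * (s * η) := by nlinarith [mul_pos hs hη]
    have h2 : |B| < √(B ^ 2 + 4 * A * (s * η)) := by
      rw [← Real.sqrt_sq_eq_abs]
      exact Real.sqrt_lt_sqrt (sq_nonneg B) hΔ
    have h3 : -B ≤ |B| := neg_le_abs B
    linarith

/-- The stable root is a root: with `Δ = B² + 4Asη ≥ 0` and `B + √Δ ≠ 0`,
`ξ* = 2sη / (B + √Δ)` satisfies `A ξ*² + B ξ* − sη = 0`. -/
theorem rqs_inv_root {A B η : ℝ} (hΔ : 0 ≤ B ^ 2 + 4 * A * (s * η))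
    (hu : B + √(B ^ 2 + 4 * A * (s * η)) ≠ 0) :
    A * (2 * (s * η) / (B + √(B ^ 2 + 4 * A * (s * η)))) ^ 2 +
      B * (2 * (s * η) / (B + √(B ^ 2 + 4 * A * (s * η)))) + -(s * η) = 0 := by
  set r := √(B ^ 2 + 4 * A * (s * η)) with hr
  have hr2 : r ^ 2 = B ^ 2 + 4 * A * (s * η) := by rw [hr]; exact Real.sq_sqrt hΔ
  have key : A * (2 * (s * η)) ^ 2 + B * (2 * (s * η)) * (B + r) + -(s * η) * (B + r) ^ 2 = 0 := by
    linear_combination (-(s * η)) * hr2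
  calc A * (2 * (s * η) / (B + r)) ^ 2 + B * (2 * (s * η) / (B + r)) + -(s * η)
      = (A * (2 * (s * η)) ^ 2 + B * (2 * (s * η)) * (B + r) + -(s * η) * (B + r) ^ 2) /
          (B + r) ^ 2 := by
        field_simp
    _ = 0 := by rw [key, zero_div]

/-- **The inverse lands in the bin**: for `η ∈ [0, 1]`, `ξ*(η) = 2sη / (B + √(B² + 4Asη)) ∈ [0, 1]`
(the upper bound is `η ≤ 1 = (A + B)/s`). -/
theorem rqs_inv_mem_Icc (hs : 0 < s) (hd₀ : 0 < d₀) (hd₁ : 0 < d₁) {η : ℝ} (h0 : 0 ≤ η)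
    (h1 : η ≤ 1) :
    2 * (s * η) / ((d₀ - (d₁ + d₀ - 2 * s) * η) +
      √((d₀ - (d₁ + d₀ - 2 * s) * η) ^ 2 + 4 * ((s - d₀) + (d₁ + d₀ - 2 * s) * η) * (s * η)))
        ∈ Icc (0 : ℝ) 1 := by
  have hu := rqs_invDen_pos hs hd₀ d₁ h0
  set B := d₀ - (d₁ + d₀ - 2 * s) * η with hB
  set A := (s - d₀) + (d₁ + d₀ - 2 * s) * η with hA
  have hAB : A + B = s := by rw [hA, hB]; ring
  have hΔ : 0 ≤ B ^ 2 + 4 * A * (s * η) := rqs_discr_nonneg hs hd₀ hd₁ h0 h1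
  refine ⟨div_nonneg (by positivity) hu.le, ?_⟩
  rw [div_le_one hu]
  -- `2sη ≤ B + √Δ`: trivial if `2sη − B ≤ 0`, else square both sides and use `A + B = s`.
  by_cases hc' : 2 * (s * η) - B ≤ 0
  · linarith [Real.sqrt_nonneg (B ^ 2 + 4 * A * (s * η))]
  · have hc : 0 < 2 * (s * η) - B := not_le.1 hc'
    have hη : 0 < η := by
      by_contra hη
      have : η = 0 := le_antisymm (not_lt.1 hη) h0
      rw [this] at hc hB; simp only [mul_zero, sub_zero] at hc hB; linarith
    have key : (2 * (s * η) - B) ^ 2 ≤ B ^ 2 + 4 * A * (s * η) := by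
      have : A = s - B := by linarith
      rw [this]
      nlinarith [mul_pos hs hη, mul_nonneg (mul_pos hs hη).le (sub_nonneg.2 h1)]
    have h2 : 2 * (s * η) - B ≤ √(B ^ 2 + 4 * A * (s * η)) := by
      rw [← Real.sqrt_sq hc.le]
      exact Real.sqrt_le_sqrt key
    linarith

/-- **`R ∘ ξ* = id` on `[0, 1]`**: the engine's `rqs_inverse` followed by `rqs_forward` is the
identity on every bin (exactly, not to a tolerance). -/
theorem rqs_apply_inv (hs : 0 < s) (hd₀ : 0 < d₀) (hd₁ : 0 < d₁) {η : ℝ} (h0 : 0 ≤ η)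
    (h1 : η ≤ 1) :
    let ξ := 2 * (s * η) / ((d₀ - (d₁ + d₀ - 2 * s) * η) +
      √((d₀ - (d₁ + d₀ - 2 * s) * η) ^ 2 + 4 * ((s - d₀) + (d₁ + d₀ - 2 * s) * η) * (s * η)))
    (s * ξ ^ 2 + d₀ * (ξ * (1 - ξ))) / (s + (d₁ + d₀ - 2 * s) * (ξ * (1 - ξ))) = η := by
  intro ξ
  have hmem : ξ ∈ Icc (0 : ℝ) 1 := rqs_inv_mem_Icc hs hd₀ hd₁ h0 h1
  have hden := rqs_den_pos hs hd₀ hd₁ hmem.1 hmem.2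
  have hroot := rqs_inv_root (rqs_discr_nonneg hs hd₀ hd₁ h0 h1) (rqs_invDen_pos hs hd₀ d₁ h0).ne'
  rw [div_eq_iff hden.ne']
  linear_combination hroot

/-- **`ξ* ∘ R = id` on `[0, 1]`**: `rqs_forward` followed by `rqs_inverse` is the identity on every
bin.  (From `rqs_apply_inv` and injectivity.) -/
theorem rqs_inv_apply (hs : 0 < s) (hd₀ : 0 < d₀) (hd₁ : 0 < d₁) {ξ : ℝ} (h0 : 0 ≤ ξ)
    (h1 : ξ ≤ 1) :
    let η := (s * ξ ^ 2 + d₀ * (ξ * (1 - ξ))) / (s + (d₁ + d₀ - 2 * s) * (ξ * (1 - ξ)))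
    2 * (s * η) / ((d₀ - (d₁ + d₀ - 2 * s) * η) +
      √((d₀ - (d₁ + d₀ - 2 * s) * η) ^ 2 + 4 * ((s - d₀) + (d₁ + d₀ - 2 * s) * η) * (s * η))) = ξ := by
  intro η
  have hη : η ∈ Icc (0 : ℝ) 1 := rqs_mapsTo hs hd₀ hd₁ ⟨h0, h1⟩
  have hmem := rqs_inv_mem_Icc hs hd₀ hd₁ hη.1 hη.2
  exact (rqs_bijOn hs hd₀ hd₁).injOn hmem ⟨h0, h1⟩ (rqs_apply_inv hs hd₀ hd₁ hη.1 hη.2)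

end Segment

/-! ## The physical bin `[x₀, x₀ + w] → [y₀, y₀ + h]` -/

section Bin

variable {x₀ y₀ w h d₀ d₁ : ℝ}

/-- **Derivative of the bin map**: for non-vanishing denominator at `ξ = (x − x₀)/w`,
`d/dx [y₀ + h R((x − x₀)/w)] = (h/w) R'(ξ)` (for `w = 0` both sides degenerate consistently, by
the `x / 0 = 0` convention; the engine has `w > 0`). -/
theorem hasDerivAt_rqsBin {x : ℝ}
    (hden : h / w + (d₁ + d₀ - 2 * (h / w)) * ((x - x₀) / w * (1 - (x - x₀) / w)) ≠ 0) :
    HasDerivAt (fun t : ℝ => y₀ + h * ((h / w * ((t - x₀) / w) ^ 2 +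
        d₀ * ((t - x₀) / w * (1 - (t - x₀) / w))) /
        (h / w + (d₁ + d₀ - 2 * (h / w)) * ((t - x₀) / w * (1 - (t - x₀) / w)))))
      (h / w * (h / w * (d₁ * ((x - x₀) / w) ^ 2 + 2 * (h / w) * ((x - x₀) / w * (1 - (x - x₀) / w)) +
        d₀ * (1 - (x - x₀) / w) ^ 2) /
        (h / w + (d₁ + d₀ - 2 * (h / w)) * ((x - x₀) / w * (1 - (x - x₀) / w))) ^ 2)) x := by
  have hin : HasDerivAt (fun t : ℝ => (t - x₀) / w) (1 / w) x := by
    simpa using ((hasDerivAt_id' x).sub_const x₀).div_const w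
  have hR := hasDerivAt_rqs (s := h / w) (d₀ := d₀) (d₁ := d₁) hden
  refine (((hR.comp x hin).const_mul h).const_add y₀).congr_deriv ?_
  rw [mul_comm _ (1 / w), ← mul_assoc, mul_one_div]

/-- The engine's `dydx`: `(h/w) R'(ξ) = s² (d₁ ξ² + 2s ξ(1−ξ) + d₀ (1−ξ)²) / den²` with `s = h/w`. -/
theorem rqsBin_dydx_eq (s ξ d₀ d₁ : ℝ) :
    s * (s * (d₁ * ξ ^ 2 + 2 * s * (ξ * (1 - ξ)) + d₀ * (1 - ξ) ^ 2) /
        (s + (d₁ + d₀ - 2 * s) * (ξ * (1 - ξ))) ^ 2) =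
      s ^ 2 * (d₁ * ξ ^ 2 + 2 * s * (ξ * (1 - ξ)) + d₀ * (1 - ξ) ^ 2) /
        (s + (d₁ + d₀ - 2 * s) * (ξ * (1 - ξ))) ^ 2 := by
  ring

/-- The bin map at the left knot: `y(x₀) = y₀`. -/
theorem rqsBin_apply_left (x₀ y₀ w h d₀ d₁ : ℝ) :
    y₀ + h * ((h / w * ((x₀ - x₀) / w) ^ 2 + d₀ * ((x₀ - x₀) / w * (1 - (x₀ - x₀) / w))) /
        (h / w + (d₁ + d₀ - 2 * (h / w)) * ((x₀ - x₀) / w * (1 - (x₀ - x₀) / w)))) = y₀ := by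
  simp

/-- The bin map at the right knot: `y(x₀ + w) = y₀ + h` (`w, h ≠ 0`). -/
theorem rqsBin_apply_right (hw : w ≠ 0) (hh : h ≠ 0) (x₀ y₀ d₀ d₁ : ℝ) :
    y₀ + h * ((h / w * ((x₀ + w - x₀) / w) ^ 2 + d₀ * ((x₀ + w - x₀) / w * (1 - (x₀ + w - x₀) / w))) /
        (h / w + (d₁ + d₀ - 2 * (h / w)) * ((x₀ + w - x₀) / w * (1 - (x₀ + w - x₀) / w)))) =
      y₀ + h := by
  have h1 : (x₀ + w - x₀) / w = 1 := by rw [add_sub_cancel_left, div_self hw]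
  rw [h1]
  have hs : h / w ≠ 0 := div_ne_zero hh hw
  simp [hs]

/-- The slope at the left knot is `d₀` (`w, h ≠ 0`). -/
theorem rqsBin_deriv_left (hw : w ≠ 0) (hh : h ≠ 0) (x₀ d₀ d₁ : ℝ) :
    h / w * (h / w * (d₁ * ((x₀ - x₀) / w) ^ 2 + 2 * (h / w) * ((x₀ - x₀) / w * (1 - (x₀ - x₀) / w)) +
        d₀ * (1 - (x₀ - x₀) / w) ^ 2) /
        (h / w + (d₁ + d₀ - 2 * (h / w)) * ((x₀ - x₀) / w * (1 - (x₀ - x₀) / w))) ^ 2) = d₀ := by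
  have h1 : (x₀ - x₀) / w = 0 := by simp
  rw [h1, rqsDeriv_apply_zero (div_ne_zero hh hw)]
  field_simp

/-- The slope at the right knot is `d₁` (`w, h ≠ 0`): consecutive bins glue `C¹`. -/
theorem rqsBin_deriv_right (hw : w ≠ 0) (hh : h ≠ 0) (x₀ d₀ d₁ : ℝ) :
    h / w * (h / w * (d₁ * ((x₀ + w - x₀) / w) ^ 2 +
        2 * (h / w) * ((x₀ + w - x₀) / w * (1 - (x₀ + w - x₀) / w)) +
        d₀ * (1 - (x₀ + w - x₀) / w) ^ 2) /
        (h / w + (d₁ + d₀ - 2 * (h / w)) * ((x₀ + w - x₀) / w * (1 - (x₀ + w - x₀) / w))) ^ 2) = d₁ := by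
  have h1 : (x₀ + w - x₀) / w = 1 := by rw [add_sub_cancel_left, div_self hw]
  rw [h1, rqsDeriv_apply_one (div_ne_zero hh hw)]
  field_simp

end Bin

end Summit.Ventures.LatticeQCDFlow.Exactness
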